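import Summits.AtomisticToContinuum.BoseEinsteinCondensation.Theses.BECFeynmanVortexArea
import HarnessLib.Audit

/-!
# Birth skeleton (BC3) for the crux `BECFeynmanVortexArea.VortexAreaFloor`
(crux item stmt-AtomisticToContinuum-12603, rank 2, route `route-AtomisticToContinuum-BECFeynmanVortexArea`;
published as `Cruxes/VortexAreaFloor/Lines/birth.lean`)

Crux (FIXED, by name): `VortexAreaFloor` — for bounded repulsive finite-range `v` with `∫v ≠ 0` and all
`C, Λ > 0` there are `c, ρ₀ > 0` such that for `0 < ρ < ρ₀`, eventually in `L`, for every `N` with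
`N/L³ ∈ [ρ/2, 2ρ]`, every positive translation-invariant `C¹` periodic ground state `Φ`, every `k ≠ 0` with
`‖k‖² ≤ Cρ` and every `C¹` periodic symmetric Bloch-`k` map `F` with `∫|F|²Φ² = 1`, `∫|∇F|²Φ² ≤ Λ‖k‖²`:
`c‖k‖² ≤ ∫ J_F Φ²`, `J_F = √((Σ(Re ∂F)²)(Σ(Im ∂F)²) − (Σ Re ∂F·Im ∂F)²)` (the 2-Jacobian `|dRe F ∧ dIm F|`).

## The reduction recorded here: "WLOG the top dyadic band, WLOG smooth maps"

The quadratic AREA floor is scale-free DOWNWARD in the momentum, by the p-fold phase-winding map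
`F ↦ φ_ε ∘ F`, `φ_ε(z) = h_ε(|z|)·(z/|z|)^p`, `h_ε(r) = r − ε·arctan(r/ε)` (a `C¹` self-map of `ℂ`
with `φ_ε(e^{iα}z) = e^{ipα}φ_ε(z)`): it sends Bloch-`k` maps to Bloch-`pk` maps, multiplies the
kinetic density by at most `‖Dφ_ε‖²_op ≤ p²` (singular values `h'_ε ≤ 1`, `p·h_ε(r)/r ≤ p`) but the
2-Jacobian only by `det Dφ_ε = p·h_ε h'_ε/r ≤ p` (`d(Re φ∘F) ∧ d(Im φ∘F) = det Dφ(F)·dRe F ∧ dIm F`).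
So a floor `c‖k'‖² ≤ ∫J` on the TOP band `Cρ/4 < ‖k'‖² ≤ Cρ` (at energies `≤ 4Λ‖k'‖²`) propagates to
every `0 < ‖k‖² ≤ Cρ` with constant `c·p/4 ≥ c/4`, `p = 2^j` the dyadic factor putting `pk` in the band
(energy `p²·Λ‖k‖² = Λ‖pk‖²` stays in the class). This is the AREA analogue of the route's support items
`PhasePowerBlochBound` / `OneSidedFloorBandReduction` (stmt-15246/15247, sector ENERGIES, factor `p²` on
both sides); for the area the gain is a full factor `p`, so the infrared modes `2π/L ≤ ‖k‖ ≪ √(Cρ)` —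
where the route header expects anomalies to bite first — drop out of the crux entirely. A mollification
stub upgrades the admissible maps on the band to `C^∞` (translation averages preserve periodicity, Bose
symmetry and Bloch equivariance; `DF` is uniformly continuous, so energy and area move by `< δ`).

**Stubs** (3; statements `Goal.stub_*` = the defs below; hardest = `stub_bandFloorSmooth`):
* `stub_bandFloorSmooth` (S1, XL/open — the crux's own difficulty, now only for SMOOTH maps with momentum
  in the TOP BAND `Cρ/4 < ‖k‖² ≤ Cρ`): the area floor there.
* `stub_phasePowerLift` (S2, M–L, provable now): the p-fold phase-winding comparison map — for every `C¹`
  periodic symmetric Bloch-`k` map `F` with `∫|F|²Φ² = 1`, every integer `p ≥ 1` and `δ > 0` there is a `C¹`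
  periodic symmetric Bloch-`(p•k)` map `G` with `∫|G|²Φ² = 1`, `∫|∇G|²Φ² ≤ (1+δ)p²∫|∇F|²Φ²` and
  `∫J_GΦ² ≤ (1+δ)p∫J_FΦ²` (`G = φ_ε∘F/‖φ_ε∘F‖_Φ`, `‖φ_ε∘F‖²_Φ ↑ 1` as `ε ↓ 0` by monotone convergence).
* `stub_smoothApproximation` (S3, M, provable now): `C¹ → C^∞` at fixed momentum with energy and area
  each increased by at most `δ` (mollify by a permutation-invariant bump on `(ℝ³)^N`, renormalise).
* `VortexAreaFloor_of : Goal.stub_bandFloorSmooth → Goal.stub_phasePowerLift →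
  Goal.stub_smoothApproximation → VortexAreaFloor` — the kernel-checked composition (no `sorry` of its
  own): band floor at `Λ' = 4Λ` gives `c₁`; answer `c = c₁/4`, same `ρ₀`, same eventual set of `L`; for an
  admissible `F` at momentum `k` pick `p = 2^n` with `4^n ≤ Cρ/‖k‖² < 4^{n+1}` (`exists_nat_pow_near`),
  lift (S2, `δ = 1`), smooth (S3, `δ₃ = min(2Λ, c₁/2)·‖pk‖²`), apply S1 at `pk`, cancel the finite
  `c₁‖pk‖²/2` and divide by `2p` in `ℝ≥0∞`.

Degenerate corners (checked): `N = 0` — a Bloch-`k` map on the one-point configuration space with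
`∫|F|²Φ² = 1` forces `k = 0`, so S2/S3 hold with `G = F` (empty sums: zero energy and area), while the
crux/S1 are vacuous there (density window `ρ/2 ≤ 0/L³` fails); `L ≤ 0` —
`cellN N L = ∅` for `N ≥ 1`, no `Φ` exists, everything vacuous; off the dual lattice the Bloch class is
`{0}` (refuter Sanity.lean `offLattice`), excluded by the normalisation. Pure-phase maps (refuter Boost.lean,
`J ≡ 0`): `φ_ε∘e^{iθ} = h_ε(1)e^{ipθ}` is again pure-phase, consistent with S2 (`0 ≤ p·0`).
Disproof.lean / landed Negative lemmas for this crux: none exist (crux dir empty at registration).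
-/

noncomputable section

namespace Summit.AtomisticToContinuum.BoseEinsteinCondensation.Cruxes.VortexAreaFloor.Birth

open MeasureTheory Filter
open scoped ENNReal NNReal BigOperators ContDiff
open Literature.MathematicalPhysics.QuantumManyBody.BoseGas
open Summit.AtomisticToContinuum.BoseEinsteinCondensation.Theses.BECFeynmanVortexArea

/-! ### Vocabulary — reducible abbreviations of the crux's own integrands (unfold definitionally) -/

/-- The directional derivative `∂_{i,t}F(X)` along the coordinate `t` of particle `i`. -/
abbrev dF {N : ℕ} (F : Config N → ℂ) (X : Config N) (i : Fin N) (t : Fin 3) : ℂ :=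
  fderiv ℝ F X (Pi.single i (EuclideanSpace.single t (1 : ℝ)))

/-- The 2-Jacobian `J_F(X) = |dRe F ∧ dIm F| = √(AB − D²)` (Gram determinant of `(∇Re F, ∇Im F)`),
verbatim the integrand of the crux. -/
abbrev jacobian {N : ℕ} (F : Config N → ℂ) (X : Config N) : ℝ :=
  Real.sqrt ((∑ i, ∑ t, (dF F X i t).re ^ 2) * (∑ i, ∑ t, (dF F X i t).im ^ 2)
    - (∑ i, ∑ t, (dF F X i t).re * (dF F X i t).im) ^ 2)

/-- `p₀`-weighted area (total Jacobian mass) `∫_cell J_F |Φ|²`. -/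
abbrev areaMass {N : ℕ} {L : ℝ} (Φ : PeriodicTrialState N L) (F : Config N → ℂ) : ℝ≥0∞ :=
  ∫⁻ X in cellN N L, ENNReal.ofReal (jacobian F X) * (‖Φ.ψ X‖₊ : ℝ≥0∞) ^ 2

/-- `p₀`-weighted kinetic energy `∫_cell |∇F|² |Φ|²`. -/
abbrev kinMass {N : ℕ} {L : ℝ} (Φ : PeriodicTrialState N L) (F : Config N → ℂ) : ℝ≥0∞ :=
  ∫⁻ X in cellN N L, kineticDensity F X * (‖Φ.ψ X‖₊ : ℝ≥0∞) ^ 2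

/-- `p₀`-weighted norm `∫_cell |F|² |Φ|²`. -/
abbrev normSq {N : ℕ} {L : ℝ} (Φ : PeriodicTrialState N L) (F : Config N → ℂ) : ℝ≥0∞ :=
  ∫⁻ X in cellN N L, (‖F X‖₊ : ℝ≥0∞) ^ 2 * (‖Φ.ψ X‖₊ : ℝ≥0∞) ^ 2

/-! ### Stub statements -/

/-- S1 (the hard core, XL/open): the area floor for SMOOTH admissible maps with momentum in the TOP dyadic
band `Cρ/4 < ‖k‖² ≤ Cρ` — the crux verbatim except for the two inserted restrictions
(`C * ρ / 4 < ‖k‖ ^ 2`, `ContDiff ℝ ∞ F`). -/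
def BandFloorSmooth : Prop :=
  ∀ v : ℝ → ℝ≥0∞, IsRepulsiveFiniteRange v → (∃ M : NNReal, ∀ r, v r ≤ M) →
    (∫⁻ x : Space, v ‖x‖) ≠ 0 → ∀ C : ℝ, 0 < C → ∀ Λ : ℝ, 0 < Λ →
    ∃ c : ℝ, 0 < c ∧ ∃ ρ₀ : ℝ, 0 < ρ₀ ∧ ∀ ρ : ℝ, 0 < ρ → ρ < ρ₀ → ∀ᶠ L : ℝ in Filter.atTop,
    ∀ N : ℕ, ρ / 2 ≤ (N : ℝ) / L ^ 3 → (N : ℝ) / L ^ 3 ≤ 2 * ρ →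
    ∀ Φ : PeriodicTrialState N L, periodicEnergy v Φ = periodicGroundStateEnergy v N L →
    periodicGroundStateEnergy v N L ≠ ⊤ → (∀ X, 0 < (Φ.ψ X).re ∧ (Φ.ψ X).im = 0) →
    (∀ (s : Space) (X : Config N), Φ.ψ (fun i => X i + s) = Φ.ψ X) →
    ∀ k : Space, k ≠ 0 → ‖k‖ ^ 2 ≤ C * ρ → C * ρ / 4 < ‖k‖ ^ 2 →
    ∀ F : Config N → ℂ, ContDiff ℝ ∞ F →
    (∀ (X : Config N) (i : Fin N) (t : Fin 3), F (X + Pi.single i (EuclideanSpace.single t L)) = F X) →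
    (∀ (σ : Equiv.Perm (Fin N)) (X : Config N), F (X ∘ σ) = F X) →
    (∀ (s : Space) (X : Config N),
      F (fun i => X i + s) = Complex.exp (Complex.I * ↑(∑ j, k j * s j)) * F X) →
    normSq Φ F = 1 → kinMass Φ F ≤ ENNReal.ofReal (Λ * ‖k‖ ^ 2) →
    ENNReal.ofReal (c * ‖k‖ ^ 2) ≤ areaMass Φ F

/-- S2 (M–L, provable now): the p-fold PHASE-WINDING LIFT `F ↦ φ_ε∘F/‖φ_ε∘F‖_Φ`,
`φ_ε(z) = h_ε(|z|)(z/|z|)^p`, `h_ε(r) = r − ε arctan(r/ε)`: Bloch-`k` ↦ Bloch-`(p•k)`, kinetic energy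
`× ≤ (1+δ)p²`, Jacobian mass `× ≤ (1+δ)p` (energy: `‖Dφ_ε‖_op ≤ p`; area: `det Dφ_ε ≤ p`; `δ` absorbs the
renormalisation `‖φ_ε∘F‖²_Φ ↑ 1`). Stated for an arbitrary weight `Φ`. -/
def PhasePowerLift : Prop :=
  ∀ (N : ℕ) (L : ℝ) (Φ : PeriodicTrialState N L) (k : Space) (F : Config N → ℂ),
    ContDiff ℝ 1 F →
    (∀ (X : Config N) (i : Fin N) (t : Fin 3), F (X + Pi.single i (EuclideanSpace.single t L)) = F X) →
    (∀ (σ : Equiv.Perm (Fin N)) (X : Config N), F (X ∘ σ) = F X) →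
    (∀ (s : Space) (X : Config N),
      F (fun i => X i + s) = Complex.exp (Complex.I * ↑(∑ j, k j * s j)) * F X) →
    normSq Φ F = 1 →
    ∀ p : ℕ, 1 ≤ p → ∀ δ : ℝ, 0 < δ →
    ∃ G : Config N → ℂ, ContDiff ℝ 1 G ∧
      (∀ (X : Config N) (i : Fin N) (t : Fin 3), G (X + Pi.single i (EuclideanSpace.single t L)) = G X) ∧
      (∀ (σ : Equiv.Perm (Fin N)) (X : Config N), G (X ∘ σ) = G X) ∧
      (∀ (s : Space) (X : Config N),
        G (fun i => X i + s) = Complex.exp (Complex.I * ↑(∑ j, ((p : ℝ) • k) j * s j)) * G X) ∧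
      normSq Φ G = 1 ∧
      kinMass Φ G ≤ ENNReal.ofReal ((1 + δ) * (p : ℝ) ^ 2) * kinMass Φ F ∧
      areaMass Φ G ≤ ENNReal.ofReal ((1 + δ) * (p : ℝ)) * areaMass Φ F

/-- S3 (M, provable now): SMOOTHING at fixed momentum — a `C¹` admissible Bloch-`k` map is replaced by a
`C^∞` one with the same periodicity / Bose symmetry / Bloch momentum, unit `Φ`-norm, and energy and area
each larger by at most `δ` (mollification by a permutation-invariant bump commutes with the three
symmetries; `DF` is uniformly continuous on the compact torus, so `|∇F_η|² → |∇F|²` and `J_{F_η} → J_F`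
uniformly against the probability weight `|Φ|²`; renormalise). -/
def SmoothApproximation : Prop :=
  ∀ (N : ℕ) (L : ℝ) (Φ : PeriodicTrialState N L) (k : Space) (F : Config N → ℂ),
    ContDiff ℝ 1 F →
    (∀ (X : Config N) (i : Fin N) (t : Fin 3), F (X + Pi.single i (EuclideanSpace.single t L)) = F X) →
    (∀ (σ : Equiv.Perm (Fin N)) (X : Config N), F (X ∘ σ) = F X) →
    (∀ (s : Space) (X : Config N),
      F (fun i => X i + s) = Complex.exp (Complex.I * ↑(∑ j, k j * s j)) * F X) →
    normSq Φ F = 1 →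
    ∀ δ : ℝ, 0 < δ →
    ∃ G : Config N → ℂ, ContDiff ℝ ∞ G ∧
      (∀ (X : Config N) (i : Fin N) (t : Fin 3), G (X + Pi.single i (EuclideanSpace.single t L)) = G X) ∧
      (∀ (σ : Equiv.Perm (Fin N)) (X : Config N), G (X ∘ σ) = G X) ∧
      (∀ (s : Space) (X : Config N),
        G (fun i => X i + s) = Complex.exp (Complex.I * ↑(∑ j, k j * s j)) * G X) ∧
      normSq Φ G = 1 ∧
      kinMass Φ G ≤ kinMass Φ F + ENNReal.ofReal δ ∧
      areaMass Φ G ≤ areaMass Φ F + ENNReal.ofReal δ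

/-! ### Audit names of the stub statements

`Goal.stub_x` abbreviates the statement of the registered stub `stub_x`, so that the skeleton audit
(`#h21_check_skeleton`, by-name policy on hypothesis heads) reads the hypotheses of `VortexAreaFloor_of`
as exactly the three declared stubs. -/

namespace Goal

/-- Statement of stub S1 `stub_bandFloorSmooth`. -/
abbrev stub_bandFloorSmooth : Prop := BandFloorSmooth

/-- Statement of stub S2 `stub_phasePowerLift`. -/
abbrev stub_phasePowerLift : Prop := PhasePowerLift

/-- Statement of stub S3 `stub_smoothApproximation`. -/
abbrev stub_smoothApproximation : Prop := SmoothApproximation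

end Goal

/-! ### Registered stubs -/

/-- S1 (XL/open, hardest): the area floor on the top dyadic band for smooth maps. -/
theorem stub_bandFloorSmooth : BandFloorSmooth := by
  sorry

/-- S2 (M–L): the p-fold phase-winding lift. -/
theorem stub_phasePowerLift : PhasePowerLift := by
  sorry

/-- S3 (M): smoothing at fixed momentum. -/
theorem stub_smoothApproximation : SmoothApproximation := by
  sorry

/-! ### Sanity (sorry-free): S1 is a restriction of the crux

The converse direction is by specialisation — the band condition is dropped and `C^∞ ⊂ C¹` — so modulo the
two provable-now stubs S2, S3 the registered line is an honest EQUIVALENT reformulation "WLOG top band,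
WLOG smooth", not a strengthening. (Not used by the skeleton theorem.) -/
theorem bandFloorSmooth_of_vortexAreaFloor (h : VortexAreaFloor) : BandFloorSmooth := by
  intro v hv hvM hint C hC Λ hΛ
  obtain ⟨c, hc, ρ₀, hρ₀, H⟩ := h v hv hvM hint C hC Λ hΛ
  refine ⟨c, hc, ρ₀, hρ₀, fun ρ hρ hρρ₀ => ?_⟩
  filter_upwards [H ρ hρ hρρ₀] with L hL
  intro N hN₁ hN₂ Φ hΦE hΦtop hΦpos hΦtr k hk hkC _hband F hF hFper hFsymm hFbloch hFnorm hFkin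
  exact hL N hN₁ hN₂ Φ hΦE hΦtop hΦpos hΦtr k hk hkC F (hF.of_le (by exact_mod_cast le_top))
    hFper hFsymm hFbloch hFnorm hFkin

/-! ### The composition (sorry-free) -/

/-- Norm of the dyadic multiple: `‖(p:ℝ) • k‖² = p² ‖k‖²`. -/
theorem norm_natCast_smul_sq (p : ℕ) (k : Space) : ‖(p : ℝ) • k‖ ^ 2 = (p : ℝ) ^ 2 * ‖k‖ ^ 2 := by
  rw [norm_smul, mul_pow, Real.norm_natCast]

/-- **Skeleton theorem.** The three stubs imply the crux `VortexAreaFloor` BY NAME: band floor at `4Λ`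
gives `c₁`; answer `c₁/4`; dyadic lift + smoothing put any admissible map into S1's class at momentum
`2^n • k` in the band; cancel and divide in `ℝ≥0∞`. -/
theorem VortexAreaFloor_of :
    Goal.stub_bandFloorSmooth → Goal.stub_phasePowerLift → Goal.stub_smoothApproximation →
      VortexAreaFloor := by
  intro hBand hLift hSmooth v hv hvM hint C hC Λ hΛ
  obtain ⟨c₁, hc₁, ρ₀, hρ₀, H⟩ := hBand v hv hvM hint C hC (4 * Λ) (by positivity)
  refine ⟨c₁ / 4, by positivity, ρ₀, hρ₀, ?_⟩
  intro ρ hρ hρρ₀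
  filter_upwards [H ρ hρ hρρ₀] with L hL
  intro N hN₁ hN₂ Φ hΦE hΦtop hΦpos hΦtr k hk hkC F hF hFper hFsymm hFbloch hFnorm hFkin
  change ENNReal.ofReal (c₁ / 4 * ‖k‖ ^ 2) ≤ areaMass Φ F
  -- positivity bookkeeping
  have hk0 : 0 < ‖k‖ := norm_pos_iff.mpr hk
  have hk2 : 0 < ‖k‖ ^ 2 := by positivity
  have hCρ : 0 < C * ρ := mul_pos hC hρ
  -- the dyadic exponent: 4^n ≤ Cρ/‖k‖² < 4^(n+1)
  obtain ⟨n, hn₁, hn₂⟩ := exists_nat_pow_near (x := C * ρ / ‖k‖ ^ 2) (y := (4 : ℝ))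
    ((one_le_div hk2).mpr hkC) (by norm_num)
  set p : ℕ := 2 ^ n with hp
  have hp1 : 1 ≤ p := Nat.one_le_two_pow
  have hpR : (p : ℝ) = 2 ^ n := by simp [hp]
  have hp0 : (0 : ℝ) < p := by rw [hpR]; positivity
  have hpsq : (p : ℝ) ^ 2 = 4 ^ n := by
    rw [hpR, ← pow_mul, mul_comm, pow_mul]; norm_num
  have hnormpk : ‖(p : ℝ) • k‖ ^ 2 = (p : ℝ) ^ 2 * ‖k‖ ^ 2 := norm_natCast_smul_sq p k
  have hpk_ne : (p : ℝ) • k ≠ 0 := smul_ne_zero hp0.ne' hk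
  have hpk_pos : 0 < ‖(p : ℝ) • k‖ ^ 2 := by rw [hnormpk]; positivity
  have hpk_le : ‖(p : ℝ) • k‖ ^ 2 ≤ C * ρ := by
    rw [hnormpk, hpsq]; exact (le_div_iff₀ hk2).mp hn₁
  have hpk_gt : C * ρ / 4 < ‖(p : ℝ) • k‖ ^ 2 := by
    rw [hnormpk, hpsq]
    have h := (div_lt_iff₀ hk2).mp hn₂
    rw [pow_succ] at h
    rw [div_lt_iff₀ (by norm_num : (0 : ℝ) < 4)]
    linarith
  -- Step 1: phase-winding lift to momentum p • k (δ = 1)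
  obtain ⟨G₁, hG₁, hG₁per, hG₁symm, hG₁bloch, hG₁norm, hG₁kin, hG₁area⟩ :=
    hLift N L Φ k F hF hFper hFsymm hFbloch hFnorm p hp1 1 one_pos
  -- Step 2: smoothing at momentum p • k with tolerance δ₃
  set δ₃ : ℝ := min (2 * Λ) (c₁ / 2) * ‖(p : ℝ) • k‖ ^ 2 with hδ₃
  have hmin : 0 < min (2 * Λ) (c₁ / 2) := lt_min (by positivity) (by positivity)
  have hδ₃pos : 0 < δ₃ := mul_pos hmin hpk_pos
  obtain ⟨G₂, hG₂, hG₂per, hG₂symm, hG₂bloch, hG₂norm, hG₂kin, hG₂area⟩ :=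
    hSmooth N L Φ ((p : ℝ) • k) G₁ hG₁ hG₁per hG₁symm hG₁bloch hG₁norm δ₃ hδ₃pos
  -- energy of G₂ stays in the class `≤ 4Λ ‖p•k‖²`
  have hδ₃kin : δ₃ ≤ 2 * Λ * ‖(p : ℝ) • k‖ ^ 2 :=
    mul_le_mul_of_nonneg_right (min_le_left _ _) hpk_pos.le
  have hδ₃area : δ₃ ≤ c₁ / 2 * ‖(p : ℝ) • k‖ ^ 2 :=
    mul_le_mul_of_nonneg_right (min_le_right _ _) hpk_pos.le
  have hkinG₂ : kinMass Φ G₂ ≤ ENNReal.ofReal (4 * Λ * ‖(p : ℝ) • k‖ ^ 2) := by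
    calc kinMass Φ G₂ ≤ kinMass Φ G₁ + ENNReal.ofReal δ₃ := hG₂kin
      _ ≤ ENNReal.ofReal ((1 + 1) * (p : ℝ) ^ 2) * kinMass Φ F
            + ENNReal.ofReal (2 * Λ * ‖(p : ℝ) • k‖ ^ 2) :=
          add_le_add hG₁kin (ENNReal.ofReal_le_ofReal hδ₃kin)
      _ ≤ ENNReal.ofReal ((1 + 1) * (p : ℝ) ^ 2) * ENNReal.ofReal (Λ * ‖k‖ ^ 2)
            + ENNReal.ofReal (2 * Λ * ‖(p : ℝ) • k‖ ^ 2) :=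
          add_le_add (mul_le_mul' le_rfl hFkin) le_rfl
      _ = ENNReal.ofReal (4 * Λ * ‖(p : ℝ) • k‖ ^ 2) := by
          rw [← ENNReal.ofReal_mul (by positivity), ← ENNReal.ofReal_add (by positivity) (by positivity),
            hnormpk]
          congr 1; ring
  -- Step 3: the band floor at the smooth map G₂ of momentum p • k
  have hfloor : ENNReal.ofReal (c₁ * ‖(p : ℝ) • k‖ ^ 2) ≤ areaMass Φ G₂ :=
    hL N hN₁ hN₂ Φ hΦE hΦtop hΦpos hΦtr ((p : ℝ) • k) hpk_ne hpk_le hpk_gt G₂ hG₂ hG₂per hG₂symm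
      hG₂bloch hG₂norm hkinG₂
  -- cancel the smoothing tolerance (finite) …
  have h1 : ENNReal.ofReal (c₁ * ‖(p : ℝ) • k‖ ^ 2)
      ≤ areaMass Φ G₁ + ENNReal.ofReal (c₁ / 2 * ‖(p : ℝ) • k‖ ^ 2) :=
    hfloor.trans (hG₂area.trans (add_le_add le_rfl (ENNReal.ofReal_le_ofReal hδ₃area)))
  have h2 : ENNReal.ofReal (c₁ / 2 * ‖(p : ℝ) • k‖ ^ 2) ≤ areaMass Φ G₁ := by
    have hsplit : ENNReal.ofReal (c₁ * ‖(p : ℝ) • k‖ ^ 2)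
        = ENNReal.ofReal (c₁ / 2 * ‖(p : ℝ) • k‖ ^ 2) + ENNReal.ofReal (c₁ / 2 * ‖(p : ℝ) • k‖ ^ 2) := by
      rw [← ENNReal.ofReal_add (by positivity) (by positivity)]
      congr 1; ring
    rw [hsplit] at h1
    exact (ENNReal.add_le_add_iff_right ENNReal.ofReal_ne_top).mp h1
  -- … and divide the lift factor 2p
  have h3 : ENNReal.ofReal (c₁ / 2 * ‖(p : ℝ) • k‖ ^ 2)
      ≤ ENNReal.ofReal ((1 + 1) * (p : ℝ)) * areaMass Φ F := h2.trans hG₁area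
  have h4 : ENNReal.ofReal (c₁ / 2 * ‖(p : ℝ) • k‖ ^ 2) / ENNReal.ofReal ((1 + 1) * (p : ℝ))
      ≤ areaMass Φ F := ENNReal.div_le_of_le_mul' h3
  have h5 : ENNReal.ofReal (c₁ / 2 * ‖(p : ℝ) • k‖ ^ 2) / ENNReal.ofReal ((1 + 1) * (p : ℝ))
      = ENNReal.ofReal (c₁ / 4 * (p : ℝ) * ‖k‖ ^ 2) := by
    rw [← ENNReal.ofReal_div_of_pos (by positivity), hnormpk]
    congr 1
    field_simp
    ring
  calc ENNReal.ofReal (c₁ / 4 * ‖k‖ ^ 2) ≤ ENNReal.ofReal (c₁ / 4 * (p : ℝ) * ‖k‖ ^ 2) := by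
        apply ENNReal.ofReal_le_ofReal
        have h1p : (1 : ℝ) ≤ p := by exact_mod_cast hp1
        have hpos : 0 ≤ c₁ / 4 * ‖k‖ ^ 2 := by positivity
        calc c₁ / 4 * ‖k‖ ^ 2 = c₁ / 4 * ‖k‖ ^ 2 * 1 := (mul_one _).symm
          _ ≤ c₁ / 4 * ‖k‖ ^ 2 * p := mul_le_mul_of_nonneg_left h1p hpos
          _ = c₁ / 4 * ↑p * ‖k‖ ^ 2 := by ring
    _ = _ := h5.symm
    _ ≤ areaMass Φ F := h4

end Summit.AtomisticToContinuum.BoseEinsteinCondensation.Cruxes.VortexAreaFloor.Birth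

end
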